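import Literature.AlgebraicGeometry.Surfaces.K3PicardRankSeventeenKugaSatakeHodge
import HarnessLib

/-!
# K3 surfaces whose rational transcendental lattice is `U² ⊥ N` (Witt index two; in particular `ρ = 16` with
# `T(S)_ℚ ≅ U_ℚ² ⊥ ⟨n₀, n₁⟩`): the Kuga–Satake correspondence is algebraic and the Hodge conjecture holds for all
# powers — from Floccari 2026 Thm. 5.11, BY NAME — PROVED modulo the cited facts

Family `hodge`, layer `Literature/AlgebraicGeometry/Surfaces`. Companion of `K3PicardRankSeventeenKugaSatakeHodge`
(cell `hodge-nonav`, planner note NOTE-KSHC-rank17 r4/r5, Lemma 1 (c) and the `ρ = 16` clause of (C5⁗): "for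
`ρ = 16` Floccari's hypothesis holds iff `T(S)_ℚ` has Witt index `2`, i.e. `T(S)_ℚ ≅ U_ℚ² ⊥ N` for a binary
space `N`"). THEOREMS ONLY (one auxiliary `def` with a body; no named fact, no instance; D-0026 net debt `0`).
Only the SUFFICIENCY direction of Lemma 1 (c) is used and proved (the necessity — a `6`-dimensional
non-degenerate subspace of the Witt-index-`3` space `(U³ ⊕ ⟨−m⟩)_ℚ` has Witt index `≥ 2` — is a limitation of
the method, not a Hodge-theoretic statement, and is not typed here).

THE QUADRATIC-FORM LEMMA (explicit, no classification needed). The diagonal form `⟨1, −1, 1, −1, n₀, n₁⟩` with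
`n₀ ≠ 0` and `n₁ < 0` embeds isometrically and injectively into `(U ⊕ U ⊕ U ⊕ ⟨−m⟩)_ℚ` for the positive
integer `m = p q` where `−n₁ = p / q`: `⟨1, −1⟩ ≅ U` twice (`e₀ ↦ (1, ½)`, `e₁ ↦ (1, −½)`), `⟨n₀⟩ ↪ U`
(`e ↦ (1, n₀/2)`), `⟨n₁⟩ ≅ ⟨−m⟩` (`e ↦ 1/q`).

WHAT IS PROVED.
* `u3mSlotEmbedSix n t`, `u3mFormQ_u3mSlotEmbedSix` — the explicit embedding `ℚ⁶ → ℚ⁷` and its isometry property.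
* `exists_u3m_embedding_hyperbolic_two` — `∃ m > 0, ∃ ι : ℚ⁶ →ₗ ℚ⁷` injective with
  `(ι x . ι y) = Σ wᵢ xᵢ yᵢ`, `w = (1, −1, 1, −1, n₀, n₁)`.
* `transcendental_u3m_embedding_of_diagonal_embedding` — GENERAL GLUE: any injective isometric embedding of the
  diagonal form `⟨w⟩` (all `wᵢ ≠ 0`) into `(U³ ⊕ ⟨−m⟩)_ℚ`, composed with the orthogonal coordinates of an
  orthogonal family `c` with weights `w` spanning the transcendental rational coordinates of a marked K3
  surface, satisfies the two binders of Floccari's facts (isometric and injective on the transcendental vectors).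
* **`IsK3Surface.isKSCorrespondenceAlgebraicBetti_of_transcendental_hyperbolic_two`**,
  **`IsK3Surface.hodgeConjectureFor_pow_of_transcendental_hyperbolic_two`** — for a K3 surface `S` with a
  Huybrechts marking `(η, p)` whose transcendental rational coordinates are spanned by an orthogonal family
  `c : Fin 6 → ℚ²²` with Gram diagonal `(1, −1, 1, −1, n₀, n₁)`, `n₀ ≠ 0`, `n₁ < 0` (i.e. `T(S)_ℚ ≅ U_ℚ² ⊥
  ⟨n₀, n₁⟩`, Witt index two, `ρ(S) = 16`): the Kuga–Satake correspondence of `S` is algebraic (Floccari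
  Thm. 5.11 (i), `hF₁`) and the Hodge conjecture holds for every power `Sᵏ` (Thm. 5.11 (ii), `hF₂`).

## References
* [Floccari2026] S. Floccari, Geom. Topol. 30 (2026) — Thm. 5.11 (i), (ii), Lemma 5.5, §5.
* [Serre1973] J.-P. Serre, *A Course in Arithmetic* — Ch. IV §1.3–§1.6 (hyperbolic planes), §3.3.
* [Huybrechts2016K3] D. Huybrechts, *Lectures on K3 Surfaces* — Ch. 3 Lemma 3.1, Ch. 4 §4, Ch. 14 §1.

## Provenance
Cell `hodge-nonav` (summit `HodgeConjecture`, rung F-H1), NOTE-KSHC-rank17 Lemma 1 (c) / (C5⁗) `ρ = 16` (P3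
g28/g29); seat `littype-FH1-2` (literature-prover, generation 17).
-/

noncomputable section

open Literature.AlgebraicTopology.SingularHomology

namespace Literature.AlgebraicGeometry.Surfaces

/-! ### §1 The explicit embedding of `⟨1, −1, 1, −1, n₀, n₁⟩` into `(U ⊕ U ⊕ U ⊕ ⟨−m⟩)_ℚ` -/

/-- The weights `(1, −1, 1, −1, n₀, n₁)`: `U_ℚ² ⊥ ⟨n₀, n₁⟩` in diagonal dress. [cite: Serre1973, Ch. IV §1.3] -/
def hyperbolicTwoWeights (n : Fin 2 → ℚ) : Fin 6 → ℚ := ![1, -1, 1, -1, n 0, n 1]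

/-- The slot embedding `ℚ⁶ → ℚ⁷`: `(x₀, x₁) ↦ (x₀ + x₁, (x₀ − x₁)/2)` in the first `U`, `(x₂, x₃)` likewise in the
second, `x₄ ↦ (x₄, n₀ x₄ / 2)` in the third, `x₅ ↦ t x₅` in `⟨−m⟩`. [cite: Serre1973, Ch. IV §1.3 and §1.6] -/
def u3mSlotEmbedSix (n : Fin 2 → ℚ) (t : ℚ) : (Fin 6 → ℚ) →ₗ[ℚ] (U3mIndex → ℚ) where
  toFun x := u3mVec (x 0 + x 1) ((x 0 - x 1) / 2) (x 2 + x 3) ((x 2 - x 3) / 2) (x 4) (n 0 * x 4 / 2) (t * x 5)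
  map_add' x y := by
    funext i
    rcases i with ((i | (i | i)) | u)
    all_goals simp only [u3mVec, Pi.add_apply]
    all_goals first | (split_ifs <;> ring) | ring
  map_smul' q x := by
    funext i
    rcases i with ((i | (i | i)) | u)
    all_goals simp only [u3mVec, Pi.smul_apply, smul_eq_mul, RingHom.id_apply]
    all_goals first | (split_ifs <;> ring) | ring

/-- **The slot embedding is an isometry from `⟨1, −1, 1, −1, n₀, n₁⟩` to `U ⊕ U ⊕ U ⊕ ⟨−m⟩` whenever
`−m t² = n₁`.** [cite: Serre1973, Ch. IV §1.3 and §1.6] -/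
theorem u3mFormQ_u3mSlotEmbedSix {m : ℕ} {n : Fin 2 → ℚ} {t : ℚ} (hmt : -((m : ℚ) * t * t) = n 1)
    (x y : Fin 6 → ℚ) :
    u3mFormQ m (u3mSlotEmbedSix n t x) (u3mSlotEmbedSix n t y) = ∑ i, hyperbolicTwoWeights n i * x i * y i := by
  change u3mFormQ m (u3mVec _ _ _ _ _ _ _) (u3mVec _ _ _ _ _ _ _) = _
  rw [u3mFormQ_u3mVec]
  simp only [hyperbolicTwoWeights, Fin.sum_univ_six, Matrix.cons_val]
  rw [← hmt]
  ring

/-- All the weights `(1, −1, 1, −1, n₀, n₁)` are non-zero when `n₀ ≠ 0`, `n₁ < 0`. [cite: Serre1973, Ch. IV §1.1] -/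
theorem hyperbolicTwoWeights_ne_zero {n : Fin 2 → ℚ} (hn0 : n 0 ≠ 0) (hn1 : n 1 < 0) (i : Fin 6) :
    hyperbolicTwoWeights n i ≠ 0 := by
  fin_cases i <;> simp [hyperbolicTwoWeights, hn0, hn1.ne]

/-- **`U_ℚ² ⊥ ⟨n₀, n₁⟩` (`n₀ ≠ 0`, `n₁ < 0`) embeds isometrically and injectively into `(U³ ⊕ ⟨−m⟩)_ℚ` for a
positive integer `m`** (NOTE-KSHC-rank17 Lemma 1 (c), sufficiency; explicit slots, `m = p q` for `−n₁ = p/q`).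
[cite: Serre1973, Ch. IV §1.3–§1.6 and §3.3] [cite: Floccari2026, Thm. 5.11 (§5)] -/
theorem exists_u3m_embedding_hyperbolic_two (n : Fin 2 → ℚ) (hn0 : n 0 ≠ 0) (hn1 : n 1 < 0) :
    ∃ m : ℕ, 0 < m ∧ ∃ ι : (Fin 6 → ℚ) →ₗ[ℚ] (U3mIndex → ℚ),
      Function.Injective ι ∧ ∀ x y, u3mFormQ m (ι x) (ι y) = ∑ i, hyperbolicTwoWeights n i * x i * y i := by
  obtain ⟨m, hm, t, hmt⟩ := exists_nat_mul_sq_eq_of_neg hn1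
  exact ⟨m, hm, u3mSlotEmbedSix n t,
    injective_of_u3mFormQ_eq (m := m) (hyperbolicTwoWeights_ne_zero hn0 hn1) (u3mFormQ_u3mSlotEmbedSix hmt),
    u3mFormQ_u3mSlotEmbedSix hmt⟩

/-! ### §2 General glue: a diagonal embedding and an orthogonal family give Floccari's binders -/

/-- **General glue.** If the diagonal form `⟨w⟩` (all `wᵢ ≠ 0`) embeds injectively and isometrically into
`(U³ ⊕ ⟨−m⟩)_ℚ` by `ι₀`, and `c` is an orthogonal family with weights `w` spanning the transcendental rational
coordinates of `S` in the marking `η`, then `ι₀ ∘ coord_c` is isometric and injective on the transcendental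
vectors — the two binders of Floccari's facts. [cite: Floccari2026, Thm. 5.11 and Lemma 5.5 (§5)]
[cite: Huybrechts2016K3, Ch. 3 Lemma 3.1 (p. 62)] -/
theorem transcendental_u3m_embedding_of_diagonal_embedding
    {S : Motives.SchemeOver ℂ} (η : HodgeTheory.complexBetti S (2 * 1) ≃ₗ[ℂ] (K3Index → ℂ))
    {r : ℕ} (c : Fin r → (K3Index → ℚ)) (w : Fin r → ℚ) (hw0 : ∀ i, w i ≠ 0)
    (hspan : ∀ v, IsTranscendentalCoord S η v → v ∈ Submodule.span ℚ (Set.range c))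
    (hgram : ∀ i j, k3FormRat (c i) (c j) = if i = j then w i else 0)
    {m : ℕ} (ι₀ : (Fin r → ℚ) →ₗ[ℚ] (U3mIndex → ℚ)) (hinj₀ : Function.Injective ι₀)
    (hiso₀ : ∀ x y, u3mFormQ m (ι₀ x) (ι₀ y) = ∑ i, w i * x i * y i) :
    (∀ v u : K3Index → ℚ, IsTranscendentalCoord S η v → IsTranscendentalCoord S η u →
        u3mFormQ m ((ι₀ ∘ₗ k3OrthCoords c w) v) ((ι₀ ∘ₗ k3OrthCoords c w) u) = k3FormRat v u) ∧
      (∀ v : K3Index → ℚ, IsTranscendentalCoord S η v → (ι₀ ∘ₗ k3OrthCoords c w) v = 0 → v = 0) := by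
  refine ⟨fun v u hv hu => ?_, fun v hv h0 => ?_⟩
  · rw [LinearMap.comp_apply, LinearMap.comp_apply, hiso₀,
      k3FormRat_eq_sum_mul_k3OrthCoords c w hw0 hgram (hspan v hv) (hspan u hu)]
  · rw [LinearMap.comp_apply] at h0
    have h1 : k3OrthCoords c w v = 0 := hinj₀ (by rw [h0, map_zero])
    rw [eq_sum_k3OrthCoords_smul c w hw0 hgram (hspan v hv), h1]
    simp

/-- **Floccari's hypotheses for `T(S)_ℚ ≅ U_ℚ² ⊥ ⟨n₀, n₁⟩`**: in a marking `η`, an orthogonal family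
`c : Fin 6 → ℚ²²` with Gram diagonal `(1, −1, 1, −1, n₀, n₁)`, `n₀ ≠ 0`, `n₁ < 0`, spanning the transcendental
rational coordinates yields `m > 0` and `ι : ℚ²² →ₗ (U³ ⊕ ⟨−m⟩)_ℚ` isometric and injective on the transcendental
vectors. [cite: Floccari2026, Thm. 5.11 and Lemma 5.5 (§5)] [cite: Serre1973, Ch. IV §1.3–§1.6] -/
theorem exists_transcendental_u3m_embedding_of_hyperbolic_two
    {S : Motives.SchemeOver ℂ} (η : HodgeTheory.complexBetti S (2 * 1) ≃ₗ[ℂ] (K3Index → ℂ))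
    (n : Fin 2 → ℚ) (hn0 : n 0 ≠ 0) (hn1 : n 1 < 0) (c : Fin 6 → (K3Index → ℚ))
    (hspan : ∀ v, IsTranscendentalCoord S η v → v ∈ Submodule.span ℚ (Set.range c))
    (hgram : ∀ i j, k3FormRat (c i) (c j) = if i = j then hyperbolicTwoWeights n i else 0) :
    ∃ m : ℕ, 0 < m ∧ ∃ ι : (K3Index → ℚ) →ₗ[ℚ] (U3mIndex → ℚ),
      (∀ v u : K3Index → ℚ, IsTranscendentalCoord S η v → IsTranscendentalCoord S η u →
          u3mFormQ m (ι v) (ι u) = k3FormRat v u) ∧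
      (∀ v : K3Index → ℚ, IsTranscendentalCoord S η v → ι v = 0 → v = 0) := by
  obtain ⟨m, hm, ι₀, hinj₀, hiso₀⟩ := exists_u3m_embedding_hyperbolic_two n hn0 hn1
  exact ⟨m, hm, ι₀ ∘ₗ k3OrthCoords c (hyperbolicTwoWeights n),
    transcendental_u3m_embedding_of_diagonal_embedding η c _ (hyperbolicTwoWeights_ne_zero hn0 hn1) hspan hgram
      ι₀ hinj₀ hiso₀⟩

/-! ### §3 The theorems -/

/-- **K3 surfaces with `T(S)_ℚ ≅ U_ℚ² ⊥ ⟨n₀, n₁⟩` (Witt index two; `ρ(S) = 16`), Kuga–Satake half**: for a K3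
surface `S` with a Huybrechts marking `(η, p)` whose transcendental rational coordinates are spanned by an orthogonal
family `c : Fin 6 → ℚ²²` with Gram diagonal `(1, −1, 1, −1, n₀, n₁)`, `n₀ ≠ 0`, `n₁ < 0`, the Kuga–Satake
correspondence of `S` is algebraic — Floccari 2026 Thm. 5.11 (i) BY NAME (`hF₁`) and the explicit embedding.
[cite: Floccari2026, Thm. 5.11 (i) (§5)] [cite: Huybrechts2016K3, Ch. 3 Lemma 3.1 and Ch. 4 §4] -/
theorem IsK3Surface.isKSCorrespondenceAlgebraicBetti_of_transcendental_hyperbolic_two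
    (hF₁ : Floccari2026_kugaSatakeCorrespondence_algebraic_of_K3_of_transcendental_embedding)
    {S : Motives.SchemeOver ℂ} (hS : IsK3Surface S)
    (η : HodgeTheory.complexBetti S (2 * 1) ≃ₗ[ℂ] (K3Index → ℂ)) (p : HodgeTheory.complexBetti S (2 * 2))
    (hp : p ≠ 0) (hpi : HodgeTheory.IsIntegralClass p)
    (hgen : ∀ q : HodgeTheory.complexBetti S (2 * 2), HodgeTheory.IsIntegralClass q → ∃ n : ℤ, q = n • p)
    (hint : ∀ c : HodgeTheory.complexBetti S (2 * 1),
      HodgeTheory.IsIntegralClass c ↔ ∃ v : K3Index → ℤ, η c = fun i => (v i : ℂ))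
    (hcup : ∀ a b : HodgeTheory.complexBetti S (2 * 1),
      cupProduct (rfl : 2 * 1 + 2 * 1 = 2 * 2) a b = k3Form (η a) (η b) • p)
    (n : Fin 2 → ℚ) (hn0 : n 0 ≠ 0) (hn1 : n 1 < 0) (c : Fin 6 → (K3Index → ℚ))
    (hspan : ∀ v, IsTranscendentalCoord S η v → v ∈ Submodule.span ℚ (Set.range c))
    (hgram : ∀ i j, k3FormRat (c i) (c j) = if i = j then hyperbolicTwoWeights n i else 0) :
    HodgeTheory.IsKSCorrespondenceAlgebraicBetti hS.isSmoothProjective := by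
  obtain ⟨m, hm, ι, hiso, hinj⟩ := exists_transcendental_u3m_embedding_of_hyperbolic_two η n hn0 hn1 c hspan hgram
  exact hF₁ S hS η p hp hpi hgen hint hcup m hm ι hiso hinj

/-- **K3 surfaces with `T(S)_ℚ ≅ U_ℚ² ⊥ ⟨n₀, n₁⟩` (Witt index two; `ρ(S) = 16`), powers half**: with the data of
`IsK3Surface.isKSCorrespondenceAlgebraicBetti_of_transcendental_hyperbolic_two`, the Hodge conjecture holds for
every power `Sᵏ` — Floccari 2026 Thm. 5.11 (ii) BY NAME (`hF₂`) and the explicit embedding.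
[cite: Floccari2026, Thm. 5.11 (ii) (§5)] [cite: Huybrechts2016K3, Ch. 3 Lemma 3.1] -/
theorem IsK3Surface.hodgeConjectureFor_pow_of_transcendental_hyperbolic_two
    (hF₂ : Floccari2026_hodgeClasses_algebraic_powers_of_K3_of_transcendental_embedding)
    {S : Motives.SchemeOver ℂ} (hS : IsK3Surface S)
    (η : HodgeTheory.complexBetti S (2 * 1) ≃ₗ[ℂ] (K3Index → ℂ)) (p : HodgeTheory.complexBetti S (2 * 2))
    (hp : p ≠ 0) (hpi : HodgeTheory.IsIntegralClass p)
    (hgen : ∀ q : HodgeTheory.complexBetti S (2 * 2), HodgeTheory.IsIntegralClass q → ∃ n : ℤ, q = n • p)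
    (hint : ∀ c : HodgeTheory.complexBetti S (2 * 1),
      HodgeTheory.IsIntegralClass c ↔ ∃ v : K3Index → ℤ, η c = fun i => (v i : ℂ))
    (hcup : ∀ a b : HodgeTheory.complexBetti S (2 * 1),
      cupProduct (rfl : 2 * 1 + 2 * 1 = 2 * 2) a b = k3Form (η a) (η b) • p)
    (n : Fin 2 → ℚ) (hn0 : n 0 ≠ 0) (hn1 : n 1 < 0) (c : Fin 6 → (K3Index → ℚ))
    (hspan : ∀ v, IsTranscendentalCoord S η v → v ∈ Submodule.span ℚ (Set.range c))
    (hgram : ∀ i j, k3FormRat (c i) (c j) = if i = j then hyperbolicTwoWeights n i else 0) (k : ℕ) :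
    HodgeTheory.HodgeConjectureFor (k * 2) (Motives.SchemeOver.pow S k) := by
  obtain ⟨m, hm, ι, hiso, hinj⟩ := exists_transcendental_u3m_embedding_of_hyperbolic_two η n hn0 hn1 c hspan hgram
  exact hF₂ S hS η p hp hpi hgen hint hcup m hm ι hiso hinj k

end Literature.AlgebraicGeometry.Surfaces

end
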